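import Literature.MathematicalPhysics.QuantumFieldTheory.Balaban1983to89.B2Eq325ConcreteSchur
import Literature.MathematicalPhysics.QuantumFieldTheory.Balaban1983to89.B2Eq337LastIntegrations

/-!
# `Balaban1983to89.B2Ineq339Gathering` — [Balaban1982Higgs2] §3.B p. 591, file 3/3 of the scalar-field integration
chain: **(3.35) → (3.36)** (the substitution `Φ = √2Φ′` with the exact Jacobian) and **(3.39) «Gathering together the
equalities and the estimates»** ON THE CONCRETE (Higgs)₂,₃ CARRIER — PROVED from (3.36) = (3.37) (file 1/3), (3.25) (file
2/3) and (3.38) (p28), with the printed `O(1)` explicit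

statement-level skeleton of published theorems with citation tags; proofs where landed; nothing here is a claim about the Yang–Mills mass gap

CITATION HEADER.  T. Bałaban, *(Higgs)₂,₃ quantum fields in a finite volume. II. An upper bound*, Commun. Math. Phys. **86**
(1982) 555–594 [Balaban1982Higgs2] (cell paper B2; PDF held `paper:balaban1982-cmp86-higgs23-ii`, journal page = PDF page
+ 554; pp. 588–591 READ AS IMAGES on the ×2 renders
`run/shared/lean/pub/pub-balaban/b2b-balaban-ref1/pages/1982-cmp86-higgs23-II/1982-cmp86-higgs23-II-p034-x2.png` … `-p037-x2.png`).
Unit `lit-balaban-p15` gen 4 (Phase-2 proof seat p15; HOME `run/shared/lean/pub/lit-balaban/`).  SKELETON row **B2.Eq3.32**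
((3.30)–(3.41); fold owner r02, second readers r14/r13, referee ref-4): residue members **(3.35) → (3.36)** and
**(3.39)**; the generic substitution lemma is r14's `…B2Sect3BSmallFactors.eq336` (inner product spaces) redone for the
product configuration space (`eq336_haar`).  RELATION TO r14 g5's `…B2Eq337LastIntegrations` (p251518, landed while this
chain was being written): there (3.36) = (3.37) is proved SCHEMATICALLY for history-dependent normalized level kernels
(`lmarginal_gaussLevels_eq`) and (3.39) is the pure bookkeeping lemma `ineq339_of_335_338` with (3.36), (3.37), (3.38) as
real-number hypotheses `h336`/`h337`/`h338`; HERE those three inputs are DISCHARGED on the concrete (Higgs)₂,₃ carrier of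
files 1/3–2/3 (`eq336_concrete`, `B2Eq337ScalarIntegration.eq337`, `B2Ineq338Diamagnetic.ineq338`), so that only (3.35)
remains a hypothesis (`ineq339`); and §7 KNITS the two: `ineq339_knit` = r14's `ineq339_of_335_338` BY NAME with
`h336`/`h337`/`h338` supplied by `h336_concrete` (the (3.36) identity in r14's `ℕ`-indexed volume bookkeeping `vol`,
`vol 0 = |Λ₅⁽⁰⁾ᶜ|`, `vol k = |Λ_k|`), `eq337` and `ineq338`.  Nothing of r14's file is restated.

WHAT IS PRINTED (verbatim, p. 591 [PDF 37]): *"we get the inequality (the right side of (3.22)) ≦ ∫dΦ Z(Ã^ε)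
exp(−¼⟨Φ, Δ(Ã^ε)Φ⟩) Π_{k=0}^{K−1} ζ′_{Λ₀⁽ᵏ⁾} · exp Σ_{k=1}^{K} O((Lᵏε)^{κ₀})|Λ_k|. (3.35) The functions ζ′_{Λ₀⁽ᵏ⁾} depend on
the vector fields only. In the integral over Φ we make the transformation Φ = √2Φ′ and we get ∫dΦ′ Z(Ã^ε)
exp(−½⟨Φ′, Δ(Ã^ε)Φ′⟩) exp ½log2 Σ_{k=0}^{K}|Λ_k|. (3.36) … Gathering together the equalities and the estimates, we get
(the expression {…} on the left side of (3.22)) ≦ Π_{k=0}^{K−1} ζ′_{Λ₀⁽ᵏ⁾} exp(E_{0,s}) exp(O(1) Σ_{k=0}^{K}|Λ_k|). (3.39)"*.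

WHAT THIS MODULE PROVES (kernel-checked, 0 `sorry`, standard axioms).
§5 `eq336_haar` (the substitution for any degree-2 homogeneous `q` and any additive Haar `volume`), `card_blockSite`,
   `finrank_cfg` (`dim = N·(|Λ₅⁽⁰⁾ᶜ| + Σ_{k=1}^{K}|Λ_k|)`; the print's `exp ½log2 Σ_{k=0}^{K}|Λ_k|` counts sites per field
   component with `Λ₀ := Λ₅⁽⁰⁾ᶜ` — READING NOTE, not an erratum: the O(1) of (3.39) depends on N anyway),
   **`eq336_concrete`**: `∫dΦ Z325·e^{−¼ form325 Φ} = 2^{dim/2} ∫dΦ′ F325(Φ′)`, `eq336_printed` (the factor as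
   `exp(½ log 2 · dim)`), and `integral335_le`: `∫dΦ Z325·e^{−¼ form325 Φ} ≤ 2^{dim/2}·exp(E_{0,s})` ((3.36) = (3.37) ≤ (3.38)).
§6 **(3.39) GATHERED** (`ineq339`): if `{…} ≤ (∫dΦ Z325 e^{−¼ form325 Φ})·ζ·exp(Σ_{k=1}^{K} e_k|Λ_k|)` — (3.35) with
   `ζ = Π_{k<K} ζ′_{Λ₀⁽ᵏ⁾} ≥ 0` constant in Φ and `|e_k| ≤ C₀` (the printed `O((Lᵏε)^{κ₀}) ≤ O(1)` since `Lᵏε ≤ 1`) — then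
   `{…} ≤ ζ · exp(E_{0,s}) · exp((C₀ + ½N log 2)·(|Λ₅⁽⁰⁾ᶜ| + Σ_{k=1}^{K}|Λ_k|))`: the printed right side of (3.39) with
   `O(1) = C₀ + ½N log 2` and `Λ₀ = Λ₅⁽⁰⁾ᶜ`.
HONEST SCOPE.  (i) (3.35) itself — the use of Proposition 3.1 (3.26)/(3.30), the large-field factors (3.31), (3.33) and
the functions ζ′ (3.34) — is NOT derived here (pieces: r14's `B2Sect3BSmallFactors.ineq330/ineq331/ineq333_printed`,
`B2Eq341Zeta.zeta334`, b2b's `B2.Prop31Printed`); it enters §6 as the hypothesis `h335` in exactly the printed shape.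
(ii) (3.40) (vector fields, *"estimated in a way similar to (3.22)"*) is not touched.
-/

noncomputable section

open MeasureTheory Finset Real
open scoped BigOperators ENNReal InnerProductSpace

namespace Literature.MathematicalPhysics.QuantumFieldTheory.Balaban1983to89.B2Ineq339Gathering

open Literature.MathematicalPhysics.QuantumFieldTheory.Balaban1983to89.HiggsLattice
open Literature.MathematicalPhysics.QuantumFieldTheory.Balaban1983to89.HiggsCovariance
open Literature.MathematicalPhysics.QuantumFieldTheory.Balaban1983to89.B2Ineq338Diamagnetic
open Literature.MathematicalPhysics.QuantumFieldTheory.Balaban1983to89.B2Eq337ScalarIntegration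
open Literature.MathematicalPhysics.QuantumFieldTheory.Balaban1983to89.B2Eq325ConcreteSchur

variable {P : HiggsLattice.Params} {N K : ℕ}

/-! ## §5 (3.35) → (3.36): the substitution `Φ = √2Φ′`, and (3.36) ≤ (3.38) -/

section Eq336

/-- The substitution `Φ = √2Φ′` for a degree-2 homogeneous `q` on a finite-dimensional real space with its Lebesgue
(additive Haar) measure: `∫dΦ Z e^{−¼q(Φ)} = 2^{dim/2} ∫dΦ′ Z e^{−½q(Φ′)}` (r14's `B2Sect3BSmallFactors.eq336` is the same
statement on an inner product space; the configuration space here is a product of such). [cite: Balaban1982Higgs2, (3.36) p.591] -/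
theorem eq336_haar {E : Type*} [NormedAddCommGroup E] [NormedSpace ℝ E] [FiniteDimensional ℝ E] [MeasureSpace E]
    [BorelSpace E] [(volume : Measure E).IsAddHaarMeasure] (Z : ℝ) (q : E → ℝ)
    (hq : ∀ (c : ℝ) (x : E), q (c • x) = c ^ 2 * q x) :
    ∫ Φ : E, Z * Real.exp (-(q Φ / 4))
      = (2 : ℝ) ^ ((Module.finrank ℝ E : ℝ) / 2) * ∫ Φ' : E, Z * Real.exp (-(q Φ' / 2)) := by
  have hsub := Measure.integral_comp_smul (volume : Measure E) (fun Φ : E => Z * Real.exp (-(q Φ / 4)))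
    (Real.sqrt 2)
  have h2 : ∀ Φ' : E, Z * Real.exp (-(q (Real.sqrt 2 • Φ') / 4)) = Z * Real.exp (-(q Φ' / 2)) := by
    intro Φ'
    rw [hq, Real.sq_sqrt (by norm_num : (0 : ℝ) ≤ 2)]
    ring_nf
  simp only [h2] at hsub
  have hpow : |((Real.sqrt 2) ^ Module.finrank ℝ E)⁻¹| = ((2 : ℝ) ^ ((Module.finrank ℝ E : ℝ) / 2))⁻¹ := by
    rw [abs_inv, abs_of_pos (pow_pos (Real.sqrt_pos.2 (by norm_num : (0 : ℝ) < 2)) _), Real.sqrt_eq_rpow,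
      ← Real.rpow_natCast, ← Real.rpow_mul (by norm_num : (0 : ℝ) ≤ 2)]
    congr 2
    ring
  rw [hpow, smul_eq_mul] at hsub
  have h2pos : 0 < (2 : ℝ) ^ ((Module.finrank ℝ E : ℝ) / 2) := Real.rpow_pos_of_pos (by norm_num) _
  rw [hsub, ← mul_assoc, mul_inv_cancel₀ h2pos.ne', one_mul]

variable (R : Regions P K) (C : ChargeData N) {a : ℝ} (A : HiggsLattice.VecField P 0) {msq : ℝ}

/-- `|⋃_k Λ_k| = Σ_{k=1}^{K} |Λ_k|`. [folklore] [cite: Balaban1982Higgs2, (3.36) p.591] -/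
theorem card_blockSite : Fintype.card R.BlockSite = ∑ j : Fin K, (R.block j).card := by
  rw [Fintype.card_sigma]
  exact Finset.sum_congr rfl fun j _ => Fintype.card_coe (R.block j)

/-- The number of real integration variables in `dΦ`: `dim = N·(|Λ₅⁽⁰⁾ᶜ| + Σ_{k=1}^{K}|Λ_k|)` (the print's
`Σ_{k=0}^{K}|Λ_k|` with `Λ₀ := Λ₅⁽⁰⁾ᶜ`, per field component). [cite: Balaban1982Higgs2, (3.36) p.591] -/
theorem finrank_cfg :
    Module.finrank ℝ (Cfg R N) = N * (Fintype.card R.OutSite + ∑ j : Fin K, (R.block j).card) := by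
  rw [Module.finrank_prod, Module.finrank_pi_fintype ℝ, Module.finrank_pi_fintype ℝ, ← card_blockSite R]
  simp only [finrank_V, Finset.sum_const, Finset.card_univ, smul_eq_mul]
  ring

/-- **(3.35) → (3.36)** p. 591: *"In the integral over Φ we make the transformation Φ = √2Φ′ and we get (3.36)"* — on the
concrete carrier, with `Z(Ã^ε)e^{−¼⟨Φ,Δ(Ã^ε)Φ⟩}` the integrand left by (3.35) and the exact Jacobian:
`∫dΦ Z325 e^{−¼ form325 Φ} = 2^{N(|Λ₅⁽⁰⁾ᶜ|+Σ|Λ_k|)/2} ∫dΦ′ F325(Φ′)` ((3.25) folds `Z325 e^{−½ form325}` back into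
`F325`). [cite: Balaban1982Higgs2, (3.36) p.591] -/
theorem eq336_concrete (ha : 0 < a) (hL : 1 < P.L) (hmsq : 0 < msq) :
    ∫ Φ : Cfg R N, Z325 R C a A msq * Real.exp (-(form325 R C a A msq Φ / 4))
      = (2 : ℝ) ^ (((N * (Fintype.card R.OutSite + ∑ j : Fin K, (R.block j).card) : ℕ) : ℝ) / 2)
          * ∫ Φ' : Cfg R N, F325 R C a A msq Φ' := by
  rw [eq336_haar (Z325 R C a A msq) (form325 R C a A msq) (form325_smul R C A ha hL hmsq), finrank_cfg R]
  congr 1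
  refine integral_congr_ae (ae_of_all _ fun Φ' => ?_)
  rw [eq325_concrete R C A ha hL hmsq Φ']
  ring_nf

/-- (3.36) in the printed shape `∫dΦ′ Z e^{−½⟨Φ′,ΔΦ′⟩} · exp(½ log 2 · dim)`. [cite: Balaban1982Higgs2, (3.36) p.591] -/
theorem eq336_printed (ha : 0 < a) (hL : 1 < P.L) (hmsq : 0 < msq) :
    ∫ Φ : Cfg R N, Z325 R C a A msq * Real.exp (-(form325 R C a A msq Φ / 4))
      = (∫ Φ' : Cfg R N, Z325 R C a A msq * Real.exp (-(form325 R C a A msq Φ' / 2)))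
          * Real.exp (Real.log 2 / 2 * ((N * (Fintype.card R.OutSite + ∑ j : Fin K, (R.block j).card) : ℕ) : ℝ)) := by
  rw [eq336_haar (Z325 R C a A msq) (form325 R C a A msq) (form325_smul R C A ha hL hmsq), finrank_cfg R,
    Real.rpow_def_of_pos (by norm_num : (0 : ℝ) < 2), mul_comm]
  congr 2
  ring

/-- **(3.35) → (3.36) → (3.37) → (3.38)**: `∫dΦ Z325 e^{−¼ form325 Φ} ≤ 2^{dim/2}·exp(E_{0,s})`.
[cite: Balaban1982Higgs2, (3.36)–(3.38) p.591] -/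
theorem integral335_le (ha : 0 < a) (hL : 1 < P.L) (hmsq : 0 < msq) :
    ∫ Φ : Cfg R N, Z325 R C a A msq * Real.exp (-(form325 R C a A msq Φ / 4))
      ≤ (2 : ℝ) ^ (((N * (Fintype.card R.OutSite + ∑ j : Fin K, (R.block j).card) : ℕ) : ℝ) / 2)
          * Real.exp (E0s P C msq) := by
  rw [eq336_concrete R C A ha hL hmsq]
  exact mul_le_mul_of_nonneg_left (integral_F325_le R C A ha hL hmsq) (Real.rpow_nonneg (by norm_num) _)

end Eq336

/-! ## §6 (3.39): *"Gathering together the equalities and the estimates"* -/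

section Ineq339

variable (R : Regions P K) (C : ChargeData N) {a : ℝ} (A : HiggsLattice.VecField P 0) {msq : ℝ}

/-- **(3.39)** p. 591, GATHERED: *"Gathering together the equalities and the estimates, we get (the expression {…} on
the left side of (3.22)) ≦ Π_{k=0}^{K−1} ζ′_{Λ₀⁽ᵏ⁾} exp(E_{0,s}) exp(O(1)Σ_{k=0}^{K}|Λ_k|)"*.  HYPOTHESES = the printed
inputs: `h335` is (3.35) — `{…} ≤ (∫dΦ Z(Ã^ε)e^{−¼⟨Φ,Δ(Ã^ε)Φ⟩}) · ζ · exp(Σ_{k=1}^{K} e_k|Λ_k|)` with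
`ζ = Π_{k<K} ζ′_{Λ₀⁽ᵏ⁾} ≥ 0` (*"depend on the vector fields only"*: a constant in Φ) and `|e_k| ≤ C₀` (the printed
`O((Lᵏε)^{κ₀})`, bounded since `Lᵏε ≤ 1`).  CONCLUSION = the printed right side with `O(1) := C₀ + ½N log 2` and
`Λ₀ := Λ₅⁽⁰⁾ᶜ`, via (3.36) (`eq336_concrete`), (3.37) (`eq337`) and (3.38) (`B2Ineq338Diamagnetic.ineq338`).
[cite: Balaban1982Higgs2, (3.39) p.591] -/
theorem ineq339 (ha : 0 < a) (hL : 1 < P.L) (hmsq : 0 < msq) {lhs ζ C₀ : ℝ} {err : Fin K → ℝ} (hζ : 0 ≤ ζ)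
    (hC₀ : 0 ≤ C₀) (herr : ∀ j, |err j| ≤ C₀)
    (h335 : lhs ≤ (∫ Φ : Cfg R N, Z325 R C a A msq * Real.exp (-(form325 R C a A msq Φ / 4))) * ζ
      * Real.exp (∑ j : Fin K, err j * ((R.block j).card : ℝ))) :
    lhs ≤ ζ * Real.exp (E0s P C msq)
      * Real.exp ((C₀ + N * Real.log 2 / 2) * ((Fintype.card R.OutSite : ℝ) + ∑ j : Fin K, ((R.block j).card : ℝ))) := by
  have hout0 : 0 ≤ (Fintype.card R.OutSite : ℝ) := Nat.cast_nonneg _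
  -- the Jacobian 2^{dim/2} = exp(½ N log 2 · (|Λ₅⁽⁰⁾ᶜ| + Σ|Λ_k|))
  have hdim : (((N * (Fintype.card R.OutSite + ∑ j : Fin K, (R.block j).card) : ℕ) : ℝ) / 2)
      = N / 2 * ((Fintype.card R.OutSite : ℝ) + ∑ j : Fin K, ((R.block j).card : ℝ)) := by
    rw [Nat.cast_mul, Nat.cast_add, Nat.cast_sum]
    ring
  have hI := integral335_le R C A ha hL hmsq
  rw [hdim, Real.rpow_def_of_pos (by norm_num : (0 : ℝ) < 2)] at hI
  -- Σ e_k|Λ_k| ≤ C₀ Σ|Λ_k| ≤ C₀ (|Λ₅⁽⁰⁾ᶜ| + Σ|Λ_k|)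
  have herrsum : ∑ j : Fin K, err j * ((R.block j).card : ℝ)
      ≤ C₀ * ((Fintype.card R.OutSite : ℝ) + ∑ j : Fin K, ((R.block j).card : ℝ)) := by
    calc ∑ j : Fin K, err j * ((R.block j).card : ℝ) ≤ ∑ j : Fin K, C₀ * ((R.block j).card : ℝ) :=
          Finset.sum_le_sum fun j _ =>
            mul_le_mul_of_nonneg_right (le_trans (le_abs_self _) (herr j)) (Nat.cast_nonneg _)
      _ = C₀ * ∑ j : Fin K, ((R.block j).card : ℝ) := (Finset.mul_sum _ _ _).symm
      _ ≤ C₀ * ((Fintype.card R.OutSite : ℝ) + ∑ j : Fin K, ((R.block j).card : ℝ)) :=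
          mul_le_mul_of_nonneg_left (le_add_of_nonneg_left hout0) hC₀
  have hE : 0 < Real.exp (∑ j : Fin K, err j * ((R.block j).card : ℝ)) := Real.exp_pos _
  -- chain
  calc lhs ≤ (∫ Φ : Cfg R N, Z325 R C a A msq * Real.exp (-(form325 R C a A msq Φ / 4))) * ζ
        * Real.exp (∑ j : Fin K, err j * ((R.block j).card : ℝ)) := h335
    _ ≤ (Real.exp (Real.log 2 * (N / 2 * ((Fintype.card R.OutSite : ℝ) + ∑ j : Fin K, ((R.block j).card : ℝ))))
          * Real.exp (E0s P C msq)) * ζ * Real.exp (∑ j : Fin K, err j * ((R.block j).card : ℝ)) :=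
          mul_le_mul_of_nonneg_right (mul_le_mul_of_nonneg_right hI hζ) hE.le
    _ ≤ (Real.exp (Real.log 2 * (N / 2 * ((Fintype.card R.OutSite : ℝ) + ∑ j : Fin K, ((R.block j).card : ℝ))))
          * Real.exp (E0s P C msq)) * ζ
          * Real.exp (C₀ * ((Fintype.card R.OutSite : ℝ) + ∑ j : Fin K, ((R.block j).card : ℝ))) := by
          refine mul_le_mul_of_nonneg_left (Real.exp_le_exp.mpr herrsum) ?_
          exact mul_nonneg (mul_nonneg (Real.exp_pos _).le (Real.exp_pos _).le) hζ
    _ = ζ * Real.exp (E0s P C msq) * Real.exp ((C₀ + N * Real.log 2 / 2)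
          * ((Fintype.card R.OutSite : ℝ) + ∑ j : Fin K, ((R.block j).card : ℝ))) := by
          have : (C₀ + N * Real.log 2 / 2) * ((Fintype.card R.OutSite : ℝ) + ∑ j : Fin K, ((R.block j).card : ℝ))
              = Real.log 2 * (N / 2 * ((Fintype.card R.OutSite : ℝ) + ∑ j : Fin K, ((R.block j).card : ℝ)))
                + C₀ * ((Fintype.card R.OutSite : ℝ) + ∑ j : Fin K, ((R.block j).card : ℝ)) := by ring
          rw [this, Real.exp_add]
          ring

end Ineq339

/-! ## §7 Knitting with r14's bookkeeping lemma `B2Eq337LastIntegrations.ineq339_of_335_338` -/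

section Knit

variable (R : Regions P K) (C : ChargeData N) {a : ℝ} (A : HiggsLattice.VecField P 0) {msq : ℝ}

/-- The volumes `|Λ_k|`, `k = 0, …, K`, in r14's `ℕ`-indexed bookkeeping: `|Λ₀| := |Λ₅⁽⁰⁾ᶜ|`, `|Λ_k|` for
`1 ≤ k ≤ K`, `0` beyond. [cite: Balaban1982Higgs2, (3.36) p.591] -/
def vol (R : Regions P K) (k : ℕ) : ℝ :=
  if k = 0 then (Fintype.card R.OutSite : ℝ)
  else if h : k - 1 < K then ((R.block ⟨k - 1, h⟩).card : ℝ) else 0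

/-- The volumes are non-negative. [cite: Balaban1982Higgs2, (3.36) p.591] -/
theorem vol_nonneg (k : ℕ) : 0 ≤ vol R k := by
  unfold vol
  split_ifs <;> positivity

/-- `Σ_{k=0}^{K} |Λ_k| = |Λ₅⁽⁰⁾ᶜ| + Σ_{k=1}^{K} |Λ_k|`. [cite: Balaban1982Higgs2, (3.36) p.591] -/
theorem sum_vol : ∑ k ∈ Finset.range (K + 1), vol R k
    = (Fintype.card R.OutSite : ℝ) + ∑ j : Fin K, ((R.block j).card : ℝ) := by
  rw [Finset.sum_range_succ']
  have h0 : vol R 0 = (Fintype.card R.OutSite : ℝ) := by simp [vol]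
  have h1 : ∑ k ∈ Finset.range K, vol R (k + 1) = ∑ j : Fin K, ((R.block j).card : ℝ) := by
    rw [Finset.sum_range]
    refine Finset.sum_congr rfl fun j _ => ?_
    simp only [vol, Nat.add_one_ne_zero, if_false, Nat.add_sub_cancel, dif_pos j.isLt]
    exact congrArg (fun i : Fin K => ((R.block i).card : ℝ)) (Fin.ext (by simp))
  rw [h0, h1, add_comm]

/-- **(3.36) in r14's bookkeeping shape** (`h336` of `B2Eq337LastIntegrations.ineq339_of_335_338`), DISCHARGED on the
concrete carrier: `I₄ = exp(c₂ Σ_{k=0}^{K}|Λ_k|) · I₂` with `I₄ = ∫dΦ Z325 e^{−¼ form325 Φ}`, `I₂ = ∫dΦ′ F325(Φ′)` and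
`c₂ = ½N log 2`. [cite: Balaban1982Higgs2, (3.36) p.591] -/
theorem h336_concrete (ha : 0 < a) (hL : 1 < P.L) (hmsq : 0 < msq) :
    (∫ Φ : Cfg R N, Z325 R C a A msq * Real.exp (-(form325 R C a A msq Φ / 4)))
      = Real.exp ((N : ℝ) * Real.log 2 / 2 * ∑ k ∈ Finset.range (K + 1), vol R k)
          * ∫ Φ' : Cfg R N, F325 R C a A msq Φ' := by
  rw [eq336_concrete R C A ha hL hmsq, sum_vol R, Real.rpow_def_of_pos (by norm_num : (0 : ℝ) < 2)]
  congr 2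
  push_cast
  ring

/-- **(3.39) KNIT**: r14's bookkeeping lemma `B2Eq337LastIntegrations.ineq339_of_335_338` with its three analytic inputs
(3.36), (3.37), (3.38) supplied BY NAME from the concrete chain (`h336_concrete`, `B2Eq337ScalarIntegration.eq337`,
`B2Ineq338Diamagnetic.ineq338`) — only (3.35) (`h335`, r14's shape) remains a hypothesis:
`{…} ≤ Πζ′ · exp(E_{0,s}) · exp((½N log 2 + C₀) Σ_{k=0}^{K}|Λ_k|)`. [cite: Balaban1982Higgs2, (3.39) p.591] -/
theorem ineq339_knit (ha : 0 < a) (hL : 1 < P.L) (hmsq : 0 < msq) {lhs Zp C₀ : ℝ} {c : ℕ → ℝ} (hZp : 0 ≤ Zp)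
    (hc : ∀ k, |c k| ≤ C₀)
    (h335 : lhs ≤ (∫ Φ : Cfg R N, Z325 R C a A msq * Real.exp (-(form325 R C a A msq Φ / 4))) * Zp
      * Real.exp (∑ k ∈ Finset.Icc 1 K, c k * vol R k)) :
    lhs ≤ Zp * Real.exp (E0s P C msq)
      * Real.exp (((N : ℝ) * Real.log 2 / 2 + C₀) * ∑ k ∈ Finset.range (K + 1), vol R k) :=
  B2Eq337LastIntegrations.ineq339_of_335_338 hZp (vol_nonneg R) hc h335 (h336_concrete R C A ha hL hmsq)
    (eq337 R C A ha hL hmsq) (ineq338 C A hmsq)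

end Knit

end Literature.MathematicalPhysics.QuantumFieldTheory.Balaban1983to89.B2Ineq339Gathering
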